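import Summits.FinalStateConjecture.FinalStateConjecture.Theorems.StarvedNecksHonestFixedRadiusSettlingSheetBurialLine
import Summits.FinalStateConjecture.FinalStateConjecture.Theorems.SwallowTheDatumMGHDExists
import Summits.FinalStateConjecture.FinalStateConjecture.Theorems.SwallowTheDatumSubdataDevelopmentsEmbedLocalisationHolds
import Summits.FinalStateConjecture.FinalStateConjecture.Theorems.SwallowTheDatumUniversalSocketBagBulkReduction
import HarnessLib

/-!
# Crux `StarvedNecks.HonestFixedRadiusSettling` (stmt-FinalStateConjecture-13550), line `far-field-surgery`
# (sheet burial, lead c2): WHAT AN UNCONDITIONAL PROOF STILL OWES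

The landed composition `honestFixedRadiusSettling_of_sheetAtoms` (`…SheetBurialLine.lean`) takes the four SwallowTheDatum
route items `FarAnnulusGluing` (15427), `UniversalSocketBag` (15426), `MGHDExists` (9937), `SubdataDevelopmentsEmbed`
(10053).  Three of them are already reduced in the tree: `MGHDExists` and `SubdataDevelopmentsEmbed` to the printed
Choquet-Bruhat–Geroch theorem (named fact `choquetBruhat_geroch_exists_mghd_cauchy`, via the landed
`mghdExists_of_choquetBruhatGeroch` / `SubdataDevelopmentsEmbed.subdataDevelopmentsEmbed_of_choquetBruhatGeroch`), and
`UniversalSocketBag` to the printed Mao–Oh–Tao obstruction-free annular gluing theorem (named fact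
`MaoOhTao.ObstructionFreeAnnularGluing`) plus ONE explicit-analysis statement, the Brill–Lindquist bulk `BulkAt` with its
`N + 2` sites (via the landed `universalSocketBag_of_obstructionFreeAnnularGluing_of_bulkAt`).  Hence the display

  `choquetBruhat_geroch_exists_mghd_cauchy → FarAnnulusGluing → ObstructionFreeAnnularGluing → (bulk) → HonestFixedRadiusSettling`:

modulo two PUBLISHED theorems taken by name, the crux rests on exactly two constructive initial-data statements — the
parametric far-annulus gluing (item 15427) and the bulk.  CONDITIONAL; credits nothing by itself.
-/

set_option linter.dupNamespace false

noncomputable section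

namespace Summit.FinalStateConjecture.FinalStateConjecture.Theorems.StarvedNecks.SheetBurial

open Literature.Geometry.Lorentzian Literature.Geometry.Lorentzian.MaoOhTao
open Summit.FinalStateConjecture.FinalStateConjecture.Theses.StarvedNecks (HonestFixedRadiusSettling)
open Summit.FinalStateConjecture.FinalStateConjecture.Theses.SwallowTheDatum (FarAnnulusGluing)
open Summit.FinalStateConjecture.FinalStateConjecture.Theorems.SwallowTheDatum.ParametricKerrBurial (BulkAt)
open Summit.FinalStateConjecture.FinalStateConjecture.Theorems.SwallowTheDatum.UniversalWitnessFamily.SheetLine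
  (universalSocketBag_of_obstructionFreeAnnularGluing_of_bulkAt)

/-- **The crux from the printed Choquet-Bruhat–Geroch and Mao–Oh–Tao theorems, the far-annulus gluing item and the bulk**
(CONDITIONAL display of what an unconditional proof of `StarvedNecks.HonestFixedRadiusSettling` still owes after the
sheet-burial composition): `MGHDExists`/`SubdataDevelopmentsEmbed` come from `choquetBruhat_geroch_exists_mghd_cauchy`,
`UniversalSocketBag` from `ObstructionFreeAnnularGluing` and the bulk, and the rest is `honestFixedRadiusSettling_of_sheetAtoms`.
[cite: ChoquetBruhatGeroch1969CMP, Thm. 3] [cite: MaoOhTao2023, Thm 1.7] [cite: DafermosLuk2017, Conjecture 1] -/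
theorem honestFixedRadiusSettling_of_choquetBruhatGeroch_of_farGluing_of_bulkAt : choquetBruhat_geroch_exists_mghd_cauchy → FarAnnulusGluing → ObstructionFreeAnnularGluing → (∀ η : ℝ → ℝ, IsBump η → ∀ (εo μo M : ℝ), 0 < εo → 0 < μo → 0 < M → ∃ μ'₀ : ℝ, 0 < μ'₀ ∧ ∀ μ' : ℝ, 0 < μ' → μ' ≤ μ'₀ → BulkAt η εo μo M μ') → HonestFixedRadiusSettling := by
  intro hcbg hA hMOT hBulk
  exact honestFixedRadiusSettling_of_sheetAtoms hA (universalSocketBag_of_obstructionFreeAnnularGluing_of_bulkAt hMOT hBulk)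
    (mghdExists_of_choquetBruhatGeroch hcbg)
    (Summit.FinalStateConjecture.FinalStateConjecture.Theorems.SubdataDevelopmentsEmbed.subdataDevelopmentsEmbed_of_choquetBruhatGeroch
      hcbg)

end Summit.FinalStateConjecture.FinalStateConjecture.Theorems.StarvedNecks.SheetBurial

end
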